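import Summits.QuantumFields.BalabanUV.InfraRed.StrongCouplingSphereCalculus
import HarnessLib

/-!
# Strong-coupling front, J-SC16e: the flux bound on `SU(2) ≅ S³` for smooth test functions ("LEMMA F′",
smooth form) —
observatory of the non-perturbative crossover; no mass-gap claim

IR-3 v2 TWO-FRONT CROSSOVER LEDGER, front SC (`β₀`), SU(2), `d = 4`, Wilson normalisation `β_W = 4/g²`.
ABSOLUTE RULE of this package: No internally-minted statement may enter as a cited fact. Every hypothesis is either
kernel-proved in this package or a verbatim quotation of a PUBLISHED theorem with page reference. The manuscript(s)
under audit are NOT citable for their own disputed steps — they are the thing under adjudication; programme-internal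
(2001/route/tribunal) claims are never citable. Nothing is cited in this file: every statement is elementary and
proved here ([folklore] labels are attributions, not citations).

WHAT THIS FILE PROVES (step 1 of the kernel port of the ball-flux certificate for `QuarterCovariance`,
FRONT-SC §3n, on top of the polar divergence identity
`StrongCouplingSphereCalculus.integral_inner_eq_integral_radialDiv`):
* `frame_expansion` — `⟪w, y⟫ y + Σ_{u=i,j,k} ⟪w, y·u⟫ (y·u) = |y|² w` (the frame `{y, y·i, y·j, y·k}`);
* `radialDiv_smul` — the product rule `radialDiv (Φ W) y = Φ y · radialDiv W y + |y|² · dΦ(y)[W y]`;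
* `integral_mul_inner_eq` — `∫ Φ(x) ⟪W x, x⟫ dσ = ∫₀¹ r ∫ (Φ(rx) radialDiv W(rx) + r² dΦ(rx)[W(rx)]) dσ dr`;
* `abs_integral_mul_inner_le` — **the flux bound**: for smooth `Φ : ℍ → ℝ` with `Φ 0 = 0`, `‖dΦ‖ ≤ L`, and
  every smooth `W : ℍ → ℍ`,
  `|∫ Φ(x) ⟪W x, x⟫ dσ| ≤ L ∫₀¹ (r² ∫ |radialDiv W (rx)| dσ + r³ ∫ |W(rx)| dσ) dr`
  (`= (L/4)(⨍_{B⁴} |x| |div W| + ⨍_{B⁴} |W|)`): only the normal trace of `W` on `S³` enters the left side.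
METHOD: the divergence identity for `Φ W`, the product rule, `|Φ(y)| ≤ L|y|` (mean value inequality) and
`|dΦ(y)[v]| ≤ L|v|`, continuity of parametric integrals over the compact group, monotonicity of the radial integral.
No smallness, no numerics.

NOT CLAIMED: anything about tilted measures, Lipschitz (non-smooth) test functions, or any particular flux;
no mass-gap claim.

(v2: identical mathematics to v1; the two `local notation` lines removed and the notations spelled out, so that the
file is lint-free for the kernel lane.)
-/

noncomputable section

open MeasureTheory Filter Finset Real
open scoped NNReal Quaternion Matrix ComplexConjugate BigOperators Matrix.Norms.Frobenius ContDiff Topology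
  RealInnerProductSpace
open Matrix Complex
open Literature.MathematicalPhysics.QuantumLattice (su2Quat quatMatrix quatMatrix_mul quatMatrix_su2Quat norm_su2Quat)
open Literature.MathematicalPhysics.QuantumFieldTheory
open Literature.MathematicalPhysics.QuantumFieldTheory.SUNBakryEmery
open Literature.MathematicalPhysics.QuantumFieldTheory.Balaban1983to89.StrongCouplingVarianceWindow (qI qJ qK)

namespace Summit.QuantumFields.BalabanUV.InfraRed.StrongCouplingFluxBound

open Summit.QuantumFields.BalabanUV.InfraRed.StrongCouplingSphereCalculus


/-! ## The frame expansion and the product rule for `radialDiv` -/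

/-- **Frame expansion**: `{y, y·i, y·j, y·k}` is an orthogonal frame of vectors of length `|y|`, so
`⟪w, y⟫ y + Σ_{u = i,j,k} ⟪w, y·u⟫ (y·u) = |y|² w`. [folklore] -/
theorem frame_expansion (w y : ℍ) :
    ⟪w, y⟫ • y + (⟪w, y * qI⟫ • (y * qI) + ⟪w, y * qJ⟫ • (y * qJ) + ⟪w, y * qK⟫ • (y * qK)) =
      ‖y‖ ^ 2 • w := by
  have hn : ‖y‖ ^ 2 = y.re ^ 2 + y.imI ^ 2 + y.imJ ^ 2 + y.imK ^ 2 := by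
    rw [sq, ← Quaternion.normSq_eq_norm_mul_self, Quaternion.normSq_def']
  rw [hn]
  ext <;> simp [Quaternion.inner_def, qI, qJ, qK] <;> ring

/-- **Product rule** for the frame divergence: for a scalar `Φ` and a field `W`,
`radialDiv (Φ W) y = Φ y · radialDiv W y + |y|² · dΦ(y)[W y]`. [folklore] -/
theorem radialDiv_smul {Φ : ℍ → ℝ} {W : ℍ → ℍ} (hΦ : Differentiable ℝ Φ) (hW : Differentiable ℝ W)
    (y : ℍ) :
    radialDiv (fun x => Φ x • W x) y = Φ y * radialDiv W y + ‖y‖ ^ 2 * fderiv ℝ Φ y (W y) := by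
  have hd : ∀ h : ℍ, fderiv ℝ (fun x => Φ x • W x) y h = Φ y • fderiv ℝ W y h + fderiv ℝ Φ y h • W y := by
    intro h
    rw [show (fun x => Φ x • W x) = Φ • W from rfl, ((hΦ y).hasFDerivAt.smul (hW y).hasFDerivAt).fderiv]
    simp
  have hf := congrArg (fderiv ℝ Φ y) (frame_expansion (W y) y)
  simp only [map_add, map_smul, smul_eq_mul] at hf
  simp only [radialDiv, hd, inner_add_left, real_inner_smul_left]
  linear_combination hf

/-- Continuity of the frame divergence of a smooth field. [folklore] -/
theorem continuous_radialDiv {W : ℍ → ℍ} (hW : ContDiff ℝ ∞ W) : Continuous (radialDiv W) := by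
  have hDc : Continuous (fderiv ℝ W) := hW.continuous_fderiv (by simp)
  have h : ∀ u : ℍ, Continuous fun y : ℍ => ⟪fderiv ℝ W y (y * u), y * u⟫ := fun u =>
    (hDc.clm_apply (continuous_id.mul continuous_const)).inner (continuous_id.mul continuous_const)
  have h0 : Continuous fun y : ℍ => ⟪fderiv ℝ W y y, y⟫ := (hDc.clm_apply continuous_id).inner continuous_id
  unfold radialDiv
  exact h0.add (((h qI).add (h qJ)).add (h qK))

/-- Continuity of `su2Quat`. [folklore] -/
private theorem continuous_su2QuatFB : Continuous (su2Quat : Matrix.specialUnitaryGroup (Fin 2) ℂ → ℍ) := by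
  have h : Continuous fun g : Matrix.specialUnitaryGroup (Fin 2) ℂ => quatOfMat (g : Matrix (Fin 2) (Fin 2) ℂ) :=
    (LinearMap.continuous_of_finiteDimensional quatOfMat).comp continuous_subtype_val
  simpa only [quatOfMat_coe] using h

/-- Continuity in the radius of a spherical mean `r ↦ ∫ G (r x) dσ(x)` of a continuous `G`. [folklore] -/
theorem continuous_integral_smul {G : ℍ → ℝ} (hG : Continuous G) :
    Continuous fun r : ℝ => ∫ g : Matrix.specialUnitaryGroup (Fin 2) ℂ, G (r • su2Quat g) ∂haarProbability (Matrix.specialUnitaryGroup (Fin 2) ℂ) := by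
  have hc : Continuous (Function.uncurry fun (r : ℝ) (g : Matrix.specialUnitaryGroup (Fin 2) ℂ) => G (r • su2Quat g)) :=
    hG.comp (continuous_fst.smul (continuous_su2QuatFB.comp continuous_snd))
  have h := continuous_parametric_integral_of_continuous (μ := (haarProbability (Matrix.specialUnitaryGroup (Fin 2) ℂ))) hc isCompact_univ
  simpa only [Measure.restrict_univ] using h

/-! ## The flux identity and the flux bound -/

/-- **Polar flux identity with a scalar weight**: for smooth `Φ : ℍ → ℝ` and `W : ℍ → ℍ`,
`∫ Φ(x) ⟪W x, x⟫ dσ = ∫₀¹ r · ∫ (Φ(rx)·radialDiv W (rx) + r²·dΦ(rx)[W(rx)]) dσ dr`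
(the divergence identity for the field `Φ W`, expanded by the product rule). [folklore] -/
theorem integral_mul_inner_eq {Φ : ℍ → ℝ} {W : ℍ → ℍ} (hΦ : ContDiff ℝ ∞ Φ) (hW : ContDiff ℝ ∞ W) :
    ∫ g : Matrix.specialUnitaryGroup (Fin 2) ℂ, Φ (su2Quat g) * ⟪W (su2Quat g), su2Quat g⟫ ∂haarProbability (Matrix.specialUnitaryGroup (Fin 2) ℂ) =
      ∫ r in (0 : ℝ)..1, r * ∫ g : Matrix.specialUnitaryGroup (Fin 2) ℂ, (Φ (r • su2Quat g) * radialDiv W (r • su2Quat g) +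
        r ^ 2 * fderiv ℝ Φ (r • su2Quat g) (W (r • su2Quat g))) ∂haarProbability (Matrix.specialUnitaryGroup (Fin 2) ℂ) := by
  have h := integral_inner_eq_integral_radialDiv (W := fun x => Φ x • W x) (hΦ.smul hW)
  simp only [real_inner_smul_left] at h
  rw [h]
  refine intervalIntegral.integral_congr fun r _ => ?_
  have hΦd : Differentiable ℝ Φ := hΦ.differentiable (by simp)
  have hWd : Differentiable ℝ W := hW.differentiable (by simp)
  show r * _ = r * _
  congr 1
  refine integral_congr_ae (ae_of_all _ fun g => ?_)
  show radialDiv (fun x => Φ x • W x) (r • su2Quat g) = _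
  rw [radialDiv_smul hΦd hWd, norm_smul, norm_su2Quat, mul_one, Real.norm_eq_abs, sq_abs]

/-- Radial integration of a pointwise bound (bookkeeping for the flux bound). [folklore] -/
private theorem abs_integral_le_aux {A P Q : ℝ → ℝ} {L : ℝ} (hA : Continuous A) (hP : Continuous P)
    (hQ : Continuous Q) (hpt : ∀ r : ℝ, 0 ≤ r → |r * A r| ≤ L * (r ^ 2 * P r + r ^ 3 * Q r)) :
    |∫ r in (0 : ℝ)..1, r * A r| ≤ L * ∫ r in (0 : ℝ)..1, (r ^ 2 * P r + r ^ 3 * Q r) := by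
  have hi1 : IntervalIntegrable (fun r => |r * A r|) volume 0 1 :=
    (continuous_abs.comp (continuous_id.mul hA)).intervalIntegrable _ _
  have hi2 : IntervalIntegrable (fun r => L * (r ^ 2 * P r + r ^ 3 * Q r)) volume 0 1 :=
    (continuous_const.mul (((continuous_id.pow 2).mul hP).add ((continuous_id.pow 3).mul hQ))).intervalIntegrable
      _ _
  calc |∫ r in (0 : ℝ)..1, r * A r|
      ≤ ∫ r in (0 : ℝ)..1, |r * A r| := intervalIntegral.abs_integral_le_integral_abs zero_le_one
    _ ≤ ∫ r in (0 : ℝ)..1, L * (r ^ 2 * P r + r ^ 3 * Q r) :=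
        intervalIntegral.integral_mono_on zero_le_one hi1 hi2 fun r hr => hpt r hr.1
    _ = L * ∫ r in (0 : ℝ)..1, (r ^ 2 * P r + r ^ 3 * Q r) := intervalIntegral.integral_const_mul _ _

/-- Continuity in the radius of the weighted spherical mean of the flux identity. [folklore] -/
private theorem continuous_mean_aux {Φ : ℍ → ℝ} {W : ℍ → ℍ} (hΦ : ContDiff ℝ ∞ Φ) (hW : ContDiff ℝ ∞ W) :
    Continuous fun r : ℝ => ∫ g : Matrix.specialUnitaryGroup (Fin 2) ℂ, (Φ (r • su2Quat g) * radialDiv W (r • su2Quat g) +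
      r ^ 2 * fderiv ℝ Φ (r • su2Quat g) (W (r • su2Quat g))) ∂haarProbability (Matrix.specialUnitaryGroup (Fin 2) ℂ) := by
  have hDΦc : Continuous (fderiv ℝ Φ) := hΦ.continuous_fderiv (by simp)
  have hrx : Continuous fun p : ℝ × Matrix.specialUnitaryGroup (Fin 2) ℂ => p.1 • su2Quat p.2 :=
    continuous_fst.smul (continuous_su2QuatFB.comp continuous_snd)
  have hc : Continuous (Function.uncurry fun (r : ℝ) (g : Matrix.specialUnitaryGroup (Fin 2) ℂ) =>
      Φ (r • su2Quat g) * radialDiv W (r • su2Quat g) +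
        r ^ 2 * fderiv ℝ Φ (r • su2Quat g) (W (r • su2Quat g))) :=
    ((hΦ.continuous.comp hrx).mul ((continuous_radialDiv hW).comp hrx)).add
      ((continuous_fst.pow 2).mul ((hDΦc.comp hrx).clm_apply (hW.continuous.comp hrx)))
  have h := continuous_parametric_integral_of_continuous (μ := (haarProbability (Matrix.specialUnitaryGroup (Fin 2) ℂ))) hc isCompact_univ
  simpa only [Measure.restrict_univ] using h

/-- The pointwise-in-radius flux bound: for smooth `Φ` with `Φ 0 = 0`, `‖dΦ‖ ≤ L`, smooth `W` and `r ≥ 0`,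
`|∫ (Φ(rx)·radialDiv W (rx) + r²·dΦ(rx)[W(rx)]) dσ| ≤ L·(r ∫ |radialDiv W (rx)| dσ + r² ∫ |W(rx)| dσ)`.
[folklore] -/
theorem abs_integral_weighted_le {Φ : ℍ → ℝ} {W : ℍ → ℍ} (hΦ : ContDiff ℝ ∞ Φ) (hW : ContDiff ℝ ∞ W)
    (hΦ0 : Φ 0 = 0) {L : ℝ} (hL : ∀ y, ‖fderiv ℝ Φ y‖ ≤ L) {r : ℝ} (hr : 0 ≤ r) :
    |∫ g : Matrix.specialUnitaryGroup (Fin 2) ℂ, (Φ (r • su2Quat g) * radialDiv W (r • su2Quat g) +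
        r ^ 2 * fderiv ℝ Φ (r • su2Quat g) (W (r • su2Quat g))) ∂haarProbability (Matrix.specialUnitaryGroup (Fin 2) ℂ)| ≤
      L * (r * ∫ g : Matrix.specialUnitaryGroup (Fin 2) ℂ, |radialDiv W (r • su2Quat g)| ∂haarProbability (Matrix.specialUnitaryGroup (Fin 2) ℂ) + r ^ 2 * ∫ g : Matrix.specialUnitaryGroup (Fin 2) ℂ, ‖W (r • su2Quat g)‖ ∂haarProbability (Matrix.specialUnitaryGroup (Fin 2) ℂ)) := by
  have hΦd : Differentiable ℝ Φ := hΦ.differentiable (by simp)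
  have hΦc : Continuous Φ := hΦ.continuous
  have hWc : Continuous W := hW.continuous
  have hDΦc : Continuous (fderiv ℝ Φ) := hΦ.continuous_fderiv (by simp)
  have hRc : Continuous (radialDiv W) := continuous_radialDiv hW
  have hrx : Continuous fun g : Matrix.specialUnitaryGroup (Fin 2) ℂ => r • su2Quat g := continuous_su2QuatFB.const_smul r
  -- consequences of `‖dΦ‖ ≤ L`
  have hLip : ∀ y : ℍ, |Φ y| ≤ L * ‖y‖ := by
    intro y
    have h := convex_univ.norm_image_sub_le_of_norm_fderiv_le (𝕜 := ℝ) (f := Φ)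
      (fun x _ => (hΦd x)) (fun x _ => hL x) (Set.mem_univ 0) (Set.mem_univ y)
    simpa [hΦ0, Real.norm_eq_abs] using h
  have hD : ∀ y v : ℍ, |fderiv ℝ Φ y v| ≤ L * ‖v‖ := fun y v => by
    have h := (fderiv ℝ Φ y).le_of_opNorm_le (hL y) v
    simpa [Real.norm_eq_abs] using h
  -- the pointwise bound on the sphere of radius `r`
  have hle : ∀ g : Matrix.specialUnitaryGroup (Fin 2) ℂ, |Φ (r • su2Quat g) * radialDiv W (r • su2Quat g) +
      r ^ 2 * fderiv ℝ Φ (r • su2Quat g) (W (r • su2Quat g))| ≤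
      L * (r * |radialDiv W (r • su2Quat g)| + r ^ 2 * ‖W (r • su2Quat g)‖) := by
    intro g
    have h1 : |Φ (r • su2Quat g)| ≤ L * r := by
      have h := hLip (r • su2Quat g)
      rwa [norm_smul, norm_su2Quat, mul_one, Real.norm_eq_abs, abs_of_nonneg hr] at h
    have h2 := hD (r • su2Quat g) (W (r • su2Quat g))
    calc |Φ (r • su2Quat g) * radialDiv W (r • su2Quat g) +
          r ^ 2 * fderiv ℝ Φ (r • su2Quat g) (W (r • su2Quat g))|
        ≤ |Φ (r • su2Quat g) * radialDiv W (r • su2Quat g)| +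
          |r ^ 2 * fderiv ℝ Φ (r • su2Quat g) (W (r • su2Quat g))| := abs_add_le _ _
      _ = |Φ (r • su2Quat g)| * |radialDiv W (r • su2Quat g)| +
          r ^ 2 * |fderiv ℝ Φ (r • su2Quat g) (W (r • su2Quat g))| := by
          rw [abs_mul, abs_mul, abs_of_nonneg (sq_nonneg r)]
      _ ≤ L * r * |radialDiv W (r • su2Quat g)| + r ^ 2 * (L * ‖W (r • su2Quat g)‖) := by
          gcongr
      _ = L * (r * |radialDiv W (r • su2Quat g)| + r ^ 2 * ‖W (r • su2Quat g)‖) := by ring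
  -- integrate
  have i1 : Integrable (fun g : Matrix.specialUnitaryGroup (Fin 2) ℂ => Φ (r • su2Quat g) * radialDiv W (r • su2Quat g) +
      r ^ 2 * fderiv ℝ Φ (r • su2Quat g) (W (r • su2Quat g))) (haarProbability (Matrix.specialUnitaryGroup (Fin 2) ℂ)) :=
    integrable_of_continuous_SUN (((hΦc.comp hrx).mul (hRc.comp hrx)).add
      (continuous_const.mul ((hDΦc.comp hrx).clm_apply (hWc.comp hrx)))) _
  have iP : Integrable (fun g : Matrix.specialUnitaryGroup (Fin 2) ℂ => |radialDiv W (r • su2Quat g)|) (haarProbability (Matrix.specialUnitaryGroup (Fin 2) ℂ)) :=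
    integrable_of_continuous_SUN (continuous_abs.comp (hRc.comp hrx)) _
  have iQ : Integrable (fun g : Matrix.specialUnitaryGroup (Fin 2) ℂ => ‖W (r • su2Quat g)‖) (haarProbability (Matrix.specialUnitaryGroup (Fin 2) ℂ)) :=
    integrable_of_continuous_SUN (continuous_norm.comp (hWc.comp hrx)) _
  have i2 : Integrable (fun g : Matrix.specialUnitaryGroup (Fin 2) ℂ => L * (r * |radialDiv W (r • su2Quat g)| +
      r ^ 2 * ‖W (r • su2Quat g)‖)) (haarProbability (Matrix.specialUnitaryGroup (Fin 2) ℂ)) := ((iP.const_mul r).add (iQ.const_mul (r ^ 2))).const_mul L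
  have h := (abs_integral_le_integral_abs (μ := (haarProbability (Matrix.specialUnitaryGroup (Fin 2) ℂ)))
    (f := fun g : Matrix.specialUnitaryGroup (Fin 2) ℂ => Φ (r • su2Quat g) * radialDiv W (r • su2Quat g) +
      r ^ 2 * fderiv ℝ Φ (r • su2Quat g) (W (r • su2Quat g)))).trans (integral_mono i1.abs i2 hle)
  have e : ∫ g : Matrix.specialUnitaryGroup (Fin 2) ℂ, L * (r * |radialDiv W (r • su2Quat g)| + r ^ 2 * ‖W (r • su2Quat g)‖) ∂haarProbability (Matrix.specialUnitaryGroup (Fin 2) ℂ) =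
      L * (r * ∫ g : Matrix.specialUnitaryGroup (Fin 2) ℂ, |radialDiv W (r • su2Quat g)| ∂haarProbability (Matrix.specialUnitaryGroup (Fin 2) ℂ) + r ^ 2 * ∫ g : Matrix.specialUnitaryGroup (Fin 2) ℂ, ‖W (r • su2Quat g)‖ ∂haarProbability (Matrix.specialUnitaryGroup (Fin 2) ℂ)) := by
    rw [integral_const_mul, integral_add (iP.const_mul r) (iQ.const_mul (r ^ 2)), integral_const_mul,
      integral_const_mul]
  rw [e] at h
  exact h

/-- **The flux bound (smooth form of "LEMMA F′")**: if `Φ : ℍ → ℝ` is smooth with `Φ 0 = 0` and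
`‖dΦ‖ ≤ L` everywhere, and `W : ℍ → ℍ` is smooth, then
`|∫ Φ(x) ⟪W x, x⟫ dσ| ≤ L · ∫₀¹ (r² ∫ |radialDiv W (rx)| dσ + r³ ∫ |W(rx)| dσ) dr`
— in ball language `|⨍_{S³} Φ ⟪W, n⟫| ≤ (L/4)(⨍_{B⁴} |x|·|div W| + ⨍_{B⁴} |W|)`, since `|Φ(y)| ≤ L|y|`.
Only the NORMAL TRACE `⟪W x, x⟫` of `W` on `S³` enters the left side: this is the freedom the flux method exploits.
[folklore] -/
theorem abs_integral_mul_inner_le {Φ : ℍ → ℝ} {W : ℍ → ℍ} (hΦ : ContDiff ℝ ∞ Φ) (hW : ContDiff ℝ ∞ W)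
    (hΦ0 : Φ 0 = 0) {L : ℝ} (hL : ∀ y, ‖fderiv ℝ Φ y‖ ≤ L) :
    |∫ g : Matrix.specialUnitaryGroup (Fin 2) ℂ, Φ (su2Quat g) * ⟪W (su2Quat g), su2Quat g⟫ ∂haarProbability (Matrix.specialUnitaryGroup (Fin 2) ℂ)| ≤
      L * ∫ r in (0 : ℝ)..1, (r ^ 2 * ∫ g : Matrix.specialUnitaryGroup (Fin 2) ℂ, |radialDiv W (r • su2Quat g)| ∂haarProbability (Matrix.specialUnitaryGroup (Fin 2) ℂ) +
        r ^ 3 * ∫ g : Matrix.specialUnitaryGroup (Fin 2) ℂ, ‖W (r • su2Quat g)‖ ∂haarProbability (Matrix.specialUnitaryGroup (Fin 2) ℂ)) := by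
  rw [integral_mul_inner_eq hΦ hW]
  refine abs_integral_le_aux (continuous_mean_aux hΦ hW)
    (continuous_integral_smul (continuous_abs.comp (continuous_radialDiv hW)))
    (continuous_integral_smul (continuous_norm.comp hW.continuous)) fun r hr => ?_
  rw [abs_mul, abs_of_nonneg hr]
  calc r * |∫ g : Matrix.specialUnitaryGroup (Fin 2) ℂ, (Φ (r • su2Quat g) * radialDiv W (r • su2Quat g) +
          r ^ 2 * fderiv ℝ Φ (r • su2Quat g) (W (r • su2Quat g))) ∂haarProbability (Matrix.specialUnitaryGroup (Fin 2) ℂ)|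
      ≤ r * (L * (r * ∫ g : Matrix.specialUnitaryGroup (Fin 2) ℂ, |radialDiv W (r • su2Quat g)| ∂haarProbability (Matrix.specialUnitaryGroup (Fin 2) ℂ) +
          r ^ 2 * ∫ g : Matrix.specialUnitaryGroup (Fin 2) ℂ, ‖W (r • su2Quat g)‖ ∂haarProbability (Matrix.specialUnitaryGroup (Fin 2) ℂ))) := by
        gcongr
        exact abs_integral_weighted_le hΦ hW hΦ0 hL hr
    _ = L * (r ^ 2 * ∫ g : Matrix.specialUnitaryGroup (Fin 2) ℂ, |radialDiv W (r • su2Quat g)| ∂haarProbability (Matrix.specialUnitaryGroup (Fin 2) ℂ) +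
          r ^ 3 * ∫ g : Matrix.specialUnitaryGroup (Fin 2) ℂ, ‖W (r • su2Quat g)‖ ∂haarProbability (Matrix.specialUnitaryGroup (Fin 2) ℂ)) := by ring

end Summit.QuantumFields.BalabanUV.InfraRed.StrongCouplingFluxBound
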